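import Summits.BirchSwinnertonDyer.BirchSwinnertonDyer.Theorems.EisensteinPrimesCrystalTransportsMu
import Summits.BirchSwinnertonDyer.BirchSwinnertonDyer.Theorems.EisensteinPrimesCrystalTransportsLambda
import Summits.BirchSwinnertonDyer.BirchSwinnertonDyer.Theorems.EisensteinPrimesCrystalLambdaSigma
import Summits.BirchSwinnertonDyer.BirchSwinnertonDyer.Theorems.EisensteinPrimesBSDpOnCellCImprimitiveCountWallOfInputs
import Summits.BirchSwinnertonDyer.BirchSwinnertonDyer.Theorems.EisensteinPrimesBSDpOnCellCBrOmegaMultOfPrint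
import Summits.BirchSwinnertonDyer.BirchSwinnertonDyer.Theorems.EisensteinPrimesBSDpOnCellCImprimitiveCountNonsplitOfPrint
import Summits.BirchSwinnertonDyer.BirchSwinnertonDyer.Theorems.SchneiderFreeAdditiveX3PoitouTateSelmerDualityHolds
import Summits.BirchSwinnertonDyer.BirchSwinnertonDyer.Theorems.SchneiderFreeAdditiveX3PoitouTateShaDualityHolds
import Literature.NumberTheory.IwasawaTheory.Greenberg2006.LocalH2VanishingOfLOC1
import Summits.BirchSwinnertonDyer.BirchSwinnertonDyer.Theorems.EisensteinPrimesBSDpOnCellCResidualV11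
import Summits.BirchSwinnertonDyer.BirchSwinnertonDyer.Theorems.EisensteinPrimesKellerYinLemma511OfBr
import Summits.BirchSwinnertonDyer.BirchSwinnertonDyer.Theorems.EisensteinPrimesKellerYinBROmegaLightBridges
import Summits.BirchSwinnertonDyer.BirchSwinnertonDyer.Theorems.EisensteinPrimesBSDpOnCellCImprimitiveCountSplitTransport
import Summits.BirchSwinnertonDyer.BirchSwinnertonDyer.Theorems.EisensteinPrimesBSDpOnCellCImprimitiveCountSplitOfBrHlatLightTC
import Summits.BirchSwinnertonDyer.BirchSwinnertonDyer.Theorems.EisensteinPrimesBSDpOnCellCAccumDefs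
import Summits.BirchSwinnertonDyer.BirchSwinnertonDyer.Theorems.EisensteinPrimesResidualCharacterSelmerFiniteOfFact
import Summits.BirchSwinnertonDyer.Rank1Residual.X2.CpIntSeriesCongruenceLimit
import Literature.NumberTheory.EllipticCurves.Skinner2016.HidaCongruentMembers
import Literature.NumberTheory.EllipticCurves.BDPAnticyclotomicPAdicLFunctionSigmaInt
import Literature.NumberTheory.EllipticCurves.SigmaEulerData
import Summits.BirchSwinnertonDyer.BirchSwinnertonDyer.Theorems.ErratumRoadFiveSigmaEulerFactorFirstUnitCoeff
import Summits.BirchSwinnertonDyer.BirchSwinnertonDyer.Theorems.EisensteinPrimesNumPlacesAboveRepresentatives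
import Summits.BirchSwinnertonDyer.BirchSwinnertonDyer.Theorems.UniversalToricDescentSigmaEulerMuZero
import Summits.BirchSwinnertonDyer.BirchSwinnertonDyer.Theorems.ErratumRoadFiveIMCDivRoadFFSigmaDataBNoDefect
import Summits.BirchSwinnertonDyer.Rank1Residual.X11b.RouteR1IntReceptacle
import Literature.NumberTheory.EllipticCurves.KellerYin2024.AnticyclotomicLocalEulerFactors
import Literature.NumberTheory.EllipticCurves.HasseWeilAbelianBadReduction
import Literature.NumberTheory.EllipticCurves.HasseWeilGoodReductionFrobenius
import Literature.NumberTheory.GaloisCohomology.CyclotomicCharacterPPrimary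
import Literature.NumberTheory.GaloisRepresentations.LocalFrobeniusDensity
import HarnessLib

/-!
# Crux 4 `BSDpOnCellC` (stmt-BirchSwinnertonDyer-19034), line «crystal» v9: THE COMPOSITION OF RECORD AS A TREE THEOREM — the crux BY NAME from the
# SEVEN registered stub texts as hypotheses (the crux-3 `…OfNamedFactsV12` pattern; cell `bsd-eis`, LEAD cruxlead-19034 g0; `--supports -19034`)

HONEST FRAMING (run/shared/lean/pub/bsd-eis/): ONE conditional theorem; its seven hypotheses are the registered stub texts of `Lines/crystal.lean` v8
VERBATIM — `hPub` = `stub_publishedFacts` (26 PUBLISHED named facts: b1's 17 MINUS the two Poitou–Tate dualities (tree theorems of bsd-schneider door-c4 g18 for every number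
field, rebuilt into V11's 17-tuple below), the TEN of p668130'' MINUS Greenberg 2006 §5 A (tree theorem `sec5A_localH2_subsingleton_of_LOC1_holds`), CGLS Thm. 1.2.2's
ω-partner and φ-half readings `thm122_fe_omegaPartner_charGrDual_torsion_muZero_lambda_eq` / `thm122_charGrDual_torsion_muZero_firstUnit_lambda_eq` (x2-p2 g12, p687863/p688467)),
`hTwoVar` = `stub_twoVarRatDivPNew`, `hDescent` = `stub_acDescent` (line «accum»'s two stubs, ideator bsd-idea-12 g15), `hFibre` = `stub_crystallineFibre` (I),
`hMember` = `stub_memberInvariants` (i) ∧ (ii′), `hWall` = `stub_wallAlgebraic` = [BR𝟙] ∧ [BRω-split]-light (TWO character main conjectures, both used at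
the ANOMALOUS local type only), `hMCB` = `stub_mazurMC_cellB` (crux 3); conclusion `…Theses.EisensteinPrimes.BSDpOnCellC` BY NAME. Nothing is asserted;
closing the crux = proving the seven hypotheses by name. TERM: b1's V11 kernel statement (p623440) fed with road R-β from «accum» (`hDescent hTwoVar`),
Keller–Yin Lemma 5.1.1 DERIVED (`KellerYinLemma511OfBr.lemma511_OPEN_of_prop125_of_br_of_pub`, p684188: seven PUB + [BR𝟙] + [BRω-split]), both μ-slots
(`CrystalTransports.muFrame_of_…` ⟸ (I) + (i), p688552), the NON-SPLIT count (x2-p2 g12 `CharGrSelmerCorankGeOfFacts.imprimitiveCount_nonsplit_of_an_of_brPrinted_of_pub''`: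
ELEVEN PUB incl. the φ-half + [BRω-mult] DERIVED from the ω-partner fact via `BrOmegaMultOfPrint.brOmegaMult_light_of_print` (p688155) and the LEAD's
bridge `KellerYinBROmegaLightBridges.brOmegaMult_heavy_of_light` (p684333) + [AN-mult] DERIVED `CrystalTransports.han_of_…` ⟸ (I) + (II)
`CrystalLambdaSigma.lambda_sigmaEulerElement` (p687555) + (ii) ⟸ (ii′) `memberLambdaCount_of_free`), the SPLIT count (x2-p2 g11/g12
`ImprimitiveCountSplitTransport.imprimitiveCount_split_of_hlatLight` (p684074) ∘ `SplitMultWallHlatLight.imprimitiveCount_split_hlatLight_of_br_of_pub_tc`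
(p686519) ∘ `ImprimitiveCountWallOfInputs.brOmegaSplit_medium_of_light` / `CrystalTransports.hanSplitLight_of_…` (p688601)), crux 3. CONDITIONAL-RESULT;
no summit statement, no BSD / MC / IMC is proved for any curve; 0 cells / labels / tiers move.

References: [KellerYin2024] Thm. 5.1.3 = Thm. D, Lemma 5.1.1, Lemma 5.1.2, Thm. 1.2.2 (arXiv:2402.12781v2) (shape only); [CastellaGrossiLeeSkinner2022]
Prop. 1.2.5, Cor. 1.2.6, Thm. 1.2.2, Thm. 2.1.2, Thm. 2.2.1–2.2.2; [Castella2020JIMJ] Def. 1.3, Thm. 1.4 (i); [Kriz2016] Thm. 3, Prop. 37; [Hsieh2014] Thm. 1;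
[CastellaGrossiSkinner2025] Thm. 3.3.1; cell: `Lines/crystal.lean` v8, `Lines/crystal.md` r8, `Lines/accum.md`.
-/

set_option autoImplicit false
set_option linter.dupNamespace false

noncomputable section


open scoped Classical MatrixGroups ModularForm

open CongruenceSubgroup WeierstrassCurve NumberField IsDedekindDomain Field PowerSeries
  Literature.NumberTheory.EllipticCurves Literature.NumberTheory.EllipticCurves.GreenbergSelmer
  Literature.NumberTheory.EllipticCurves.ModularForms Literature.NumberTheory.QuadraticFields
  Literature.NumberTheory.EllipticCurves.Rank1Residual
  Literature.NumberTheory.EllipticCurves.Rank1Residual.Typed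
  Literature.NumberTheory.EllipticCurves.KrizLi2019
  Literature.NumberTheory.EllipticCurves.GreenbergVatsal2000
  Literature.NumberTheory.EllipticCurves.Wuthrich2014
  Literature.NumberTheory.EllipticCurves.SteinWuthrich2013
  Literature.NumberTheory.EllipticCurves.Castella2018Exceptional
  Literature.NumberTheory.GaloisRepresentations Literature.NumberTheory.GaloisCohomology
  Literature.NumberTheory.Automorphic
  Summit.BirchSwinnertonDyer.Rank1Residual.X11b.AcSelmer
  Summit.BirchSwinnertonDyer.Rank1Residual.X11b.Halves
  Summit.BirchSwinnertonDyer.Rank1Residual.X11b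
  Summit.BirchSwinnertonDyer.Rank1Residual Summit.BirchSwinnertonDyer.Rank1Residual.X1
  Summit.BirchSwinnertonDyer.Rank1Residual.X2
open Literature.NumberTheory.EllipticCurves.KellerYin2024 (curveLocalLambda)



namespace Summit.BirchSwinnertonDyer.BirchSwinnertonDyer.Theorems.EisensteinPrimesBSDpOnCellCOfNamedFactsV9

open Literature.NumberTheory.EllipticCurves.CastellaGrossiLeeSkinner2022 Literature.NumberTheory.EllipticCurves.Castella2018
  Literature.NumberTheory.IwasawaTheory Literature.NumberTheory.IwasawaTheory.Greenberg2016
  Literature.NumberTheory.IwasawaTheory.Greenberg2006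
  Summit.BirchSwinnertonDyer.Rank1Residual.X1.KellerYinMuLambdaSplit
open Literature.NumberTheory.EllipticCurves.KellerYin2024
open Summit.BirchSwinnertonDyer.BirchSwinnertonDyer.Theorems.EisensteinPrimesBSDpOnCellCAccumDefs (TwoVarRatDivPNew)

/-- **Crux 4 `BSDpOnCellC` BY NAME from the seven registered stub texts of line «crystal» v9** (see the module docstring for what each
hypothesis is and how the term is assembled). CONDITIONAL; nothing asserted. [claim: KellerYin2024, status: under-review]
[cite: KellerYin2024, Thm. 5.1.3 = Thm. D, Lemma 5.1.1, Thm. 1.2.2 (arXiv:2402.12781v2) (shape only)]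
[cite: CastellaGrossiLeeSkinner2022, Prop. 1.2.5, Thm. 1.2.2, Thm. 2.1.2, Thm. 2.2.2] [cite: Castella2020JIMJ, Def. 1.3 and Thm. 1.4 (i)] [cite: Kriz2016, Thm. 3]
[cite: Hsieh2014, Thm. 1] [cite: CastellaGrossiSkinner2025, Thm. 3.3.1] -/
theorem bsdpOnCellC_of_namedFactsV9
    (hPub :
    (((lambdaMu_multiplicative_of_gvPar ∧ thm16_charIdeal_dvd_multiplicative_of_reducible ∧
    thm61_splitMultiplicative ∧ thm61_nonsplitMultiplicative ∧
    (∀ (W : WeierstrassCurve ℚ) [W.IsElliptic] [W.IsGloballyMinimal] (p : ℕ) [Fact p.Prime],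
      greenberg_stevens (W := W) (p := p)) ∧
    exists_isNewformOf ∧
    hsieh2014_exists_anticyclotomicPAdicLFunction ∧
    (∀ (N : ℕ) [NeZero N] (W : WeierstrassCurve ℚ) (K : Type) [Field K] [NumberField K],
      gross_zagier N W K) ∧
    (∀ (N : ℕ) [NeZero N] (W : WeierstrassCurve ℚ) (K : Type) [Field K] [NumberField K],
      kolyvagin N W K) ∧
    rank_eq_analyticRank_of_analyticRank_le_one ∧ HoffsteinLuo1997_exists_twist_L_one_ne_zero ∧
    mazur_not_dvd_maninConstant_of_odd ∧ bsdRHS_eq_of_isIsogenous) ∧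
    thm210_thm211_bdpDisplay_pNew) ∧
    LiuZhangZhang2018.thm151_thm153_modularCurve_heegnerVector) ∧
    (prop125_characterGrSelmerDual_torsion_muZero_dim ∧ prop263_sur_of_crk ∧
      cor126_residualCharacter_globalLift ∧ cor126_residualCharacter_localSurjective ∧ prop411_selmer_isAlmostDivisible ∧
      prop41_globalEulerPoincareCorank ∧ prop42_localEulerPoincareCorank ∧ prop32_cohomology_isCofinitelyGenerated ∧
      thm212_exists_isKatzLFunction ∧
      CastellaGrossiLeeSkinner2022.thm122_fe_omegaPartner_charGrDual_torsion_muZero_lambda_eq ∧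
      CastellaGrossiLeeSkinner2022.thm122_charGrDual_torsion_muZero_firstUnit_lambda_eq))
    (hTwoVar :
    ∀ (W : WeierstrassCurve ℚ) [W.IsElliptic] [W.IsGloballyMinimal] (p : ℕ) [Fact p.Prime],
      CellC W p → TwoVarRatDivPNew W p)
    (hDescent :
    (∀ (W : WeierstrassCurve ℚ) [W.IsElliptic] [W.IsGloballyMinimal] (p : ℕ) [Fact p.Prime],
      CellC W p → TwoVarRatDivPNew W p) →
    (∀ (W : WeierstrassCurve ℚ) [W.IsElliptic] [W.IsGloballyMinimal] (p : ℕ) [Fact p.Prime],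
      CellC W p → ¬ W.HasSplitMultiplicativeReductionAtPrime p → NonsplitKolyvaginDivOnTreeIntOther W p) ∧
    (∀ (W : WeierstrassCurve ℚ) [W.IsElliptic] [W.IsGloballyMinimal] (p : ℕ) [Fact p.Prime],
      CellC W p → W.HasSplitMultiplicativeReductionAtPrime p → SplitKolyvaginDivOnTreeIntOther W p))
    (hFibre :
    ∀ (W : WeierstrassCurve ℚ) [W.IsElliptic] [W.IsGloballyMinimal] (p : ℕ) [Fact p.Prime],
      ∀ (N : ℕ) [NeZero N] (K : Type) [Field K] [NumberField K],
        CellC W p → W.conductorNorm ℤ = N →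
        IsImaginaryQuadratic K → NumberField.discr K < -4 → SatisfiesHeegnerHypothesis N K →
        Odd (NumberField.discr K) →
        ∀ (κ : ZpExtension K p), κ.IsAnticyclotomic →
          ∀ (γ : Field.absoluteGaloisGroup K) [Fact (κ.IsTopGenerator γ)]
            (𝔭 : HeightOneSpectrum (𝓞 K)), ((p : ℕ) : 𝓞 K) ∈ 𝔭.asIdeal →
            𝔭.asIdeal.ramificationIdx (𝓞 ℚ) = 1 → 𝔭.asIdeal.inertiaDeg (𝓞 ℚ) = 1 →
            ∀ (𝔭bar : HeightOneSpectrum (𝓞 K)), ((p : ℕ) : 𝓞 K) ∈ 𝔭bar.asIdeal → 𝔭bar ≠ 𝔭 →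
              ((Ideal.span {(p : ℤ)}).primesOver (𝓞 K)).ncard = 2 →
            ∀ (f : CuspForm (CongruenceSubgroup.Gamma0 N) 2), IsNewformOf W f →
              ∀ (ι' : PadicAlgCl p ≃+* ℂ),
                (∀ (w : InfinitePlace K) (k : 𝓞 K),
                  k ∈ 𝔭.asIdeal ↔ ‖ι'.symm (w.embedding (k : K))‖ < 1) →
                ∀ (ΩK : ℂ) (Ωp : ℂ_[p]) (Q : PowerSeries 𝓞_ℂ_[p]), ΩK ≠ 0 → ‖Ωp‖ = 1 →
                  R1.IsBDPLFunctionInt p ι' 𝔭 κ γ f ΩK Ωp Q →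
                  ∃ (D : Skinner2016.HidaCongruentForm W p 1) (ΩK' : ℂ) (Ωp' : ℂ_[p])
                    (Qg : PowerSeries 𝓞_ℂ_[p]),
                    (∀ x : coeffField D.g, ι' (D.ι x) = (x : ℂ)) ∧ 2 * ((p : ℤ) - 1) ∣ D.k - 2 ∧
                    ΩK' ≠ 0 ∧ ‖Ωp'‖ = 1 ∧
                    IsBDPLFunctionWtSigmaInt ι' 𝔭 κ γ D.g (W.sigmaPlacesFinset p K) ΩK' Ωp' Qg ∧
                    Ideal.span {Qg} ⊔ Ideal.span {(C ((p : ℕ) : 𝓞_ℂ_[p]) : PowerSeries 𝓞_ℂ_[p])} =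
                      Ideal.span {Q * PowerSeries.map (R1.toCpInt p) (W.sigmaEulerElement p K κ)} ⊔
                        Ideal.span {(C ((p : ℕ) : 𝓞_ℂ_[p]) : PowerSeries 𝓞_ℂ_[p])})
    (hMember :
    (∀ (W : WeierstrassCurve ℚ) [W.IsElliptic] [W.IsGloballyMinimal] (p : ℕ) [Fact p.Prime],
      ∀ (N : ℕ) [NeZero N] (K : Type) [Field K] [NumberField K],
        CellC W p → W.conductorNorm ℤ = N →
        IsImaginaryQuadratic K → NumberField.discr K < -4 → SatisfiesHeegnerHypothesis N K →
        Odd (NumberField.discr K) →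
        ∀ (κ : ZpExtension K p), κ.IsAnticyclotomic →
          ∀ (γ : Field.absoluteGaloisGroup K) [Fact (κ.IsTopGenerator γ)]
            (𝔭 : HeightOneSpectrum (𝓞 K)), ((p : ℕ) : 𝓞 K) ∈ 𝔭.asIdeal →
              ((Ideal.span {(p : ℤ)}).primesOver (𝓞 K)).ncard = 2 →
            ∀ (ι' : PadicAlgCl p ≃+* ℂ),
              (∀ (w : InfinitePlace K) (k : 𝓞 K),
                k ∈ 𝔭.asIdeal ↔ ‖ι'.symm (w.embedding (k : K))‖ < 1) →
              ∀ (D : Skinner2016.HidaCongruentForm W p 1), (∀ x : coeffField D.g, ι' (D.ι x) = (x : ℂ)) →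
                ∀ (ΩK' : ℂ) (Ωp' : ℂ_[p]) (Qg : PowerSeries 𝓞_ℂ_[p]), ΩK' ≠ 0 → ‖Ωp'‖ = 1 →
                  IsBDPLFunctionWtSigmaInt ι' 𝔭 κ γ D.g (W.sigmaPlacesFinset p K) ΩK' Ωp' Qg →
                    ∃ n : ℕ, ‖((PowerSeries.coeff n Qg : 𝓞_ℂ_[p]) : ℂ_[p])‖ = 1 ∧
                      ∀ i < n, ‖((PowerSeries.coeff i Qg : 𝓞_ℂ_[p]) : ℂ_[p])‖ < 1) ∧
    (∀ (W : WeierstrassCurve ℚ) [W.IsElliptic] [W.IsGloballyMinimal] (p : ℕ) [Fact p.Prime],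
      ∀ (N : ℕ) [NeZero N] (K : Type) [Field K] [NumberField K],
        CellC W p → W.conductorNorm ℤ = N →
        IsImaginaryQuadratic K → NumberField.discr K < -4 → SatisfiesHeegnerHypothesis N K →
        Odd (NumberField.discr K) →
        ∀ (κ : ZpExtension K p), κ.IsAnticyclotomic →
          ∀ (γ : Field.absoluteGaloisGroup K) [Fact (κ.IsTopGenerator γ)]
            (𝔭 : HeightOneSpectrum (𝓞 K)), ((p : ℕ) : 𝓞 K) ∈ 𝔭.asIdeal →
            𝔭.asIdeal.ramificationIdx (𝓞 ℚ) = 1 → 𝔭.asIdeal.inertiaDeg (𝓞 ℚ) = 1 →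
            ∀ (𝔭bar : HeightOneSpectrum (𝓞 K)), ((p : ℕ) : 𝓞 K) ∈ 𝔭bar.asIdeal → 𝔭bar ≠ 𝔭 →
              ((Ideal.span {(p : ℤ)}).primesOver (𝓞 K)).ncard = 2 →
            ∀ (ι' : PadicAlgCl p ≃+* ℂ),
              (∀ (w : InfinitePlace K) (k : 𝓞 K),
                k ∈ 𝔭.asIdeal ↔ ‖ι'.symm (w.embedding (k : K))‖ < 1) →
              ∀ (D : Skinner2016.HidaCongruentForm W p 1), (∀ x : coeffField D.g, ι' (D.ι x) = (x : ℂ)) →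
                2 * ((p : ℤ) - 1) ∣ D.k - 2 →
                ∀ (ΩKg : ℂ) (Ωpg : ℂ_[p]) (Qg : PowerSeries 𝓞_ℂ_[p]), ΩKg ≠ 0 → ‖Ωpg‖ = 1 →
                  IsBDPLFunctionWtSigmaInt ι' 𝔭 κ γ D.g (W.sigmaPlacesFinset p K) ΩKg Ωpg Qg →
                  ∀ (Φ : AddSubgroup (geomTorsion W (p : ℤ))), IsRationalLine W p Φ →
                  ∀ (θsub θquot : FramedGaloisRep ℚ (padicCoeffIntegers (∅ : Set (PadicAlgCl p))) 1),
                    IsTeichmullerLiftOn (∅ : Set (PadicAlgCl p)) (Φ.map (geomTorsion W (p : ℤ)).subtype) θsub →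
                    IsTeichmullerLiftOnQuot (∅ : Set (PadicAlgCl p)) (Φ.map (geomTorsion W (p : ℤ)).subtype)
                      (geomTorsion W (p : ℤ)) θquot →
                  ∀ (φ ψ : FramedGaloisRep ℚ (padicCoeffIntegers (∅ : Set (PadicAlgCl p))) 1),
                    (φ = θsub ∧ ψ = θquot ∨ φ = θquot ∧ ψ = θsub) →
                    (∀ u : HeightOneSpectrum (𝓞 ℚ), ((p : ℕ) : 𝓞 ℚ) ∈ u.asIdeal → φ.IsUnramifiedAt u) →
                  ∀ (θK : HeckeCharacter K), IsHeckeCharOf ι' (φ.restrictField K) θK →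
                  ∀ (Cbar : Finset (HeightOneSpectrum (𝓞 K))), (∀ u ∈ Cbar, ¬ θK.IsUnramifiedAt u) →
                  ∀ (ΩK' : ℂ) (Ωp' : (unrIntegers p)ˣ) (Lφ : UnrSeries p), ΩK' ≠ 0 →
                    IsKatzLFunction ι' 𝔭 𝔭bar Cbar κ γ θK ΩK' ((Ωp' : unrIntegers p) : ℂ_[p]) Lφ →
                  ∀ nφ : ℕ, FirstUnitCoeffAt Lφ nφ →
                  ∀ n : ℕ, ‖((PowerSeries.coeff n Qg : 𝓞_ℂ_[p]) : ℂ_[p])‖ = 1 →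
                    (∀ i < n, ‖((PowerSeries.coeff i Qg : 𝓞_ℂ_[p]) : ℂ_[p])‖ < 1) →
                      n ≤ 2 * nφ + ∑ w ∈ W.sigmaPlacesFinset p K,
                        (charLocalLambda (∅ : Set (PadicAlgCl p)) κ (θsub.restrictField K) w +
                          charLocalLambda (∅ : Set (PadicAlgCl p)) κ (θquot.restrictField K) w)))
    (hWall :
    (∀ (p : ℕ) [Fact p.Prime], CharMainConjOnTree p) ∧
      (∀ (W : WeierstrassCurve ℚ) [W.IsElliptic] [W.IsGloballyMinimal] (p : ℕ) [Fact p.Prime],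
      2 < p → Mult W p → W.HasSplitMultiplicativeReductionAtPrime p →
      ∀ (K : Type) [Field K] [NumberField K],
        IsImaginaryQuadratic K → SatisfiesHeegnerHypothesis (W.conductorNorm ℤ) K →
        Odd (NumberField.discr K) → NumberField.discr K ≠ -3 →
        ∀ (κ : ZpExtension K p), κ.IsAnticyclotomic →
          ∀ (γ : Field.absoluteGaloisGroup K) [Fact (κ.IsTopGenerator γ)]
            (𝔭 : HeightOneSpectrum (𝓞 K)), ((p : ℕ) : 𝓞 K) ∈ 𝔭.asIdeal →
            𝔭.asIdeal.ramificationIdx (𝓞 ℚ) = 1 → 𝔭.asIdeal.inertiaDeg (𝓞 ℚ) = 1 →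
            ∀ (𝔭bar : HeightOneSpectrum (𝓞 K)), ((p : ℕ) : 𝓞 K) ∈ 𝔭bar.asIdeal → 𝔭bar ≠ 𝔭 →
              ((Ideal.span {(p : ℤ)}).primesOver (𝓞 K)).ncard = 2 →
            ∀ (ι' : PadicAlgCl p ≃+* ℂ),
              (∀ (w : InfinitePlace K) (k : 𝓞 K), k ∈ 𝔭.asIdeal ↔ ‖ι'.symm (w.embedding (k : K))‖ < 1) →
            ∀ (Φ : AddSubgroup (geomTorsion W (p : ℤ))), IsRationalLine W p Φ →
            ∀ (θsub θquot : FramedGaloisRep ℚ (padicCoeffIntegers (∅ : Set (PadicAlgCl p))) 1),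
              IsTeichmullerLiftOn (∅ : Set (PadicAlgCl p)) (Φ.map (geomTorsion W (p : ℤ)).subtype) θsub →
              IsTeichmullerLiftOnQuot (∅ : Set (PadicAlgCl p)) (Φ.map (geomTorsion W (p : ℤ)).subtype)
                (geomTorsion W (p : ℤ)) θquot →
            ∀ (φ ψ : FramedGaloisRep ℚ (padicCoeffIntegers (∅ : Set (PadicAlgCl p))) 1),
              (φ = θsub ∧ ψ = θquot ∨ φ = θquot ∧ ψ = θsub) →
              (∀ u : HeightOneSpectrum (𝓞 ℚ), ((p : ℕ) : 𝓞 ℚ) ∈ u.asIdeal → φ.IsUnramifiedAt u) →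
            ∀ (θK : HeckeCharacter K), IsHeckeCharOf ι' (φ.restrictField K) θK →
            ∀ (Cbar : Finset (HeightOneSpectrum (𝓞 K))), (∀ u ∈ Cbar, ¬ θK.IsUnramifiedAt u) →
            ∀ (ΩK' : ℂ) (Ωp' : (unrIntegers p)ˣ) (Lφ : UnrSeries p), ΩK' ≠ 0 →
              IsKatzLFunction ι' 𝔭 𝔭bar Cbar κ γ θK ΩK' ((Ωp' : unrIntegers p) : ℂ_[p]) Lφ →
            ∀ nφ : ℕ, FirstUnitCoeffAt Lφ nφ →
            ∀ (Dψ : DatumDualData κ γ (charModule (∅ : Set (PadicAlgCl p)) (ψ.restrictField K))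
                (Castella2018.AcSelmer.bdpData (charModule (∅ : Set (PadicAlgCl p)) (ψ.restrictField K)) p 𝔭bar)
                (∅ : Set (HeightOneSpectrum (𝓞 K)))),
              Module.Finite (IwasawaAlgebra p) Dψ.X ∧ Module.IsTorsion (IwasawaAlgebra p) Dψ.X ∧
                muInvariant p Dψ.X = 0 ∧ lambdaInvariant p Dψ.X = nφ))
    (hMCB :
    Summit.BirchSwinnertonDyer.BirchSwinnertonDyer.Theses.EisensteinPrimes.MazurMCOnCellB)
    : Summit.BirchSwinnertonDyer.BirchSwinnertonDyer.Theses.EisensteinPrimes.BSDpOnCellC := by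
  -- b1's 17-tuple `hPub.1` of V11 REBUILT: its Poitou–Tate conjuncts are the tree theorems of bsd-schneider door-c4 g18 (every number field)
  obtain ⟨⟨⟨h1, h2, h3, h4, h5, h6, h9, h10, h11, h12, h13, h14, h15⟩, h16⟩, h17⟩ := hPub.1
  exact Summit.BirchSwinnertonDyer.BirchSwinnertonDyer.Theorems.BSDpOnCellCResidualV11.bsdpOnCellC_of_publishedFacts_of_divIntOther_of_lemma511_OPEN_of_muFrame_of_imprimitiveCount_of_cellB
    ⟨⟨⟨h1, h2, h3, h4, h5, h6, fun K _ _ ↦ Summit.BirchSwinnertonDyer.BirchSwinnertonDyer.Theorems.SchneiderFreeAdditiveX3.PoitouTateReduction.poitouTate_selmerStructure_duality_holds K,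
        fun K _ _ ↦ Summit.BirchSwinnertonDyer.BirchSwinnertonDyer.Theorems.SchneiderFreeAdditiveX3.PoitouTateReduction.poitouTate_sha_tateDual_holds K, h9, h10, h11, h12, h13, h14, h15⟩, h16⟩, h17⟩
    (hDescent hTwoVar).1 (hDescent hTwoVar).2
    (Summit.BirchSwinnertonDyer.BirchSwinnertonDyer.Theorems.KellerYinLemma511OfBr.lemma511_OPEN_of_prop125_of_br_of_pub
      hPub.2.1 hPub.2.2.1 hPub.2.2.2.2.2.2.1 hPub.2.2.2.2.2.2.2.1 Literature.NumberTheory.IwasawaTheory.Greenberg2006.sec5A_localH2_subsingleton_of_LOC1_holds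
      hPub.2.2.2.2.2.2.2.2.1 hPub.2.2.2.2.2.2.2.2.2.1 (fun p _ ↦ hWall.1 p) hWall.2)
    (Summit.BirchSwinnertonDyer.BirchSwinnertonDyer.Theorems.CrystalTransports.muFrame_of_crystallineFibre_of_memberMuZero hFibre hMember.1).1
    (Summit.BirchSwinnertonDyer.BirchSwinnertonDyer.Theorems.CrystalTransports.muFrame_of_crystallineFibre_of_memberMuZero hFibre hMember.1).2
    (Summit.BirchSwinnertonDyer.BirchSwinnertonDyer.Theorems.CharGrSelmerCorankGeOfFacts.imprimitiveCount_nonsplit_of_an_of_brPrinted_of_pub''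
      hPub.2.1 hPub.2.2.1 Literature.NumberTheory.IwasawaTheory.Greenberg2006.sec5A_localH2_subsingleton_of_LOC1_holds hPub.2.2.2.1 hPub.2.2.2.2.1
      hPub.2.2.2.2.2.1 hPub.2.2.2.2.2.2.1 hPub.2.2.2.2.2.2.2.1 hPub.2.2.2.2.2.2.2.2.1 hPub.2.2.2.2.2.2.2.2.2.1 hPub.2.2.2.2.2.2.2.2.2.2.2
      (Summit.BirchSwinnertonDyer.BirchSwinnertonDyer.Theorems.KellerYinBROmegaLightBridges.brOmegaMult_heavy_of_light
        (Summit.BirchSwinnertonDyer.BirchSwinnertonDyer.Theorems.BrOmegaMultOfPrint.brOmegaMult_light_of_print hPub.2.2.2.2.2.2.2.2.2.2.1))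
      (Summit.BirchSwinnertonDyer.BirchSwinnertonDyer.Theorems.CrystalTransports.han_of_crystallineFibre_of_memberInvariants hFibre
        Summit.BirchSwinnertonDyer.BirchSwinnertonDyer.Theorems.CrystalLambdaSigma.lambda_sigmaEulerElement
        (Summit.BirchSwinnertonDyer.BirchSwinnertonDyer.Theorems.CrystalTransports.memberLambdaCount_of_free hMember.2)))
    (Summit.BirchSwinnertonDyer.BirchSwinnertonDyer.Theorems.ImprimitiveCountSplitTransport.imprimitiveCount_split_of_hlatLight h6
      (Summit.BirchSwinnertonDyer.BirchSwinnertonDyer.Theorems.SplitMultWallHlatLight.imprimitiveCount_split_hlatLight_of_br_of_pub_tc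
        hPub.2.2.1 hPub.2.2.2.2.2.2.1 hPub.2.2.2.2.2.2.2.1 Literature.NumberTheory.IwasawaTheory.Greenberg2006.sec5A_localH2_subsingleton_of_LOC1_holds hPub.2.2.2.2.2.2.2.2.1 hPub.2.2.2.2.2.2.2.2.2.1
        (fun p _ ↦ hWall.1 p) (Summit.BirchSwinnertonDyer.BirchSwinnertonDyer.Theorems.ImprimitiveCountWallOfInputs.brOmegaSplit_medium_of_light hWall.2)
        (Summit.BirchSwinnertonDyer.BirchSwinnertonDyer.Theorems.CrystalTransports.hanSplitLight_of_crystallineFibre_of_memberInvariants hFibre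
          Summit.BirchSwinnertonDyer.BirchSwinnertonDyer.Theorems.CrystalLambdaSigma.lambda_sigmaEulerElement hMember.2)))
    hMCB

end Summit.BirchSwinnertonDyer.BirchSwinnertonDyer.Theorems.EisensteinPrimesBSDpOnCellCOfNamedFactsV9

end
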